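import Summits.QuantumFields.YangMills.Theorems.BalabanUVNodesN11AtRecord12C
import Literature.MathematicalPhysics.QuantumFieldTheory.Balaban1983to89.B16NodeKnitRecord13

/-!
# DAG node N11 — [B14] `Dag.B14_main` ([Balaban1988Convergent] CMP **119** (1988) 243–285: Theorem 1 p. 262, with the Theorem of p. 245 and the
# operation 𝐑 ASSUMED on p. 244) AT NODE 00's STAGE-13 RECORD `Node00.IsRecordOfRecord₁₃C` (`Node00/Record13.lean`): the route's stub
# `YMDAG.UVSplit.S_N11 Rec := AtRecord Rec Dag.B14_main` at `Rec := IsRecordOfRecord₁₃C · N` with the (𝐑) slot DISCHARGED BY THE PIN, the §2-form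
# reading `Iff.rfl`, and the START (S0) A THEOREM (`Node00.sLaw₁₃_zero`) — N11 at a Stage-13 world = (S1ᵀ)₁₃ ALONE: the Theorem of p. 245 at the objects of record

Cell `pub-ymgap`, YM-PLAN Track A (HUMAN RULING D-0062), seat `pub-ymgap-dag-n11-d` (R134 fan-out seat N11, strategy s2 «Thm 1 with 𝐑 explicit at the record
now that `Sect2Form` is PINNED — the T-DAY consumer»), generation g4; director-ym LINE №125 «RECORD 13» ((3): every ₁₂ module re-keys BY NAME at `Record13`),
LINE №130 (2).  [III] = Balaban1988Convergent, [II′] = Balaban1989LargeFieldII, [I] = Balaban1987RG1.  The Stage-13 twin of this seat's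
`…BalabanUVNodesN11AtRecord12C` (p459309), whose stage-free (B)-face theorem `thm1Printed_of_b14_main_all` it IMPORTS (no restatement); seat dag-n24-c's
`B16NodeKnitRecord13` (the N11 ∧ N13 junction at ₁₃, whose N11 half is the same generic knit inline) is imported for the unfolded leaf and is the file
whose `nodes_N11_N13_at_record₁₃` the named N11 forms below refine.

WHY THIS FILE.  NODE 00's Stage 13 (`Record13`, seat node00-def-T, FILE 13) re-points three located proviso rows of the Stage-12 record (`rstep` in def-R's
integrable form; NO β-version field — β reads K0e's canonical-version transport `TcanOfRecord`; the β-slot small-field function = the (2.9) species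
`chiFixed29 ν ε₂₉` of [I] p. 266) and therefore RE-INSTANTIATES every history-keyed object of record along the new generated history `gOfRecord₁₃ θ p =
genSeq β₁₃ g₀` (densities `densOfRecord₁₃`, 𝐓-images `tdensOfRecord₁₃`, 𝐓-weights `WtOfRecord₁₃`, setting `settingOfRecord₁₃`, background maps
`UbgOfRecord₁₃`, the repaired format laws `SLaw₁₃` ∕ `TLaw₁₃`, the carriers `VOfRecord₁₃`, the core `coreOfRecord₁₃`, the datum `datumOfRecord₁₃`, the
record predicate `IsRecordOfRecord₁₃C`).  NO implication between the Stage-12 and Stage-13 laws holds letter for letter (Record13 (μ): the β-functions differ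
AS OBJECTS), so N11's knit at the record is RE-KEYED BY NAME, not transported: the route's rev-16 crux K1‴ `StabilityBAtRecordR13e` reads the thirteen
nodes at SOME Stage-13 record (`stub_nodes13`), and its N11 conjunct `Dag.B14_main (leavesP w P)` at a `IsRecordOfRecord₁₃C` pair is what this file
reduces to (S1ᵀ)₁₃.  Exactly as at Stage 12: `SLaw₁₃ θ P 0` is a THEOREM (`sLaw₁₃_zero`, n13-e's generic base), the core's §2 clause IS `SLaw₁₃`
(`sect2Form_coreOfRecord₁₃_iff`, `Iff.rfl`) and the record's 𝐑-leaf IS «`∀ k < K, TLaw₁₃ θ P k → SLaw₁₃ θ P (k+1)`» (`rOperation_upOfRecord₅C_stage13_iff`;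
[II′] Thm 1's content, node N13's product).  Hence at a Stage-13 world `Dag.B14_main (leavesP w P)` follows from EXACTLY (S1ᵀ)₁₃ THE THEOREM OF [III]
p. 245 AT THE STAGE-13 OBJECTS OF RECORD — «given N11's antecedents `b7 … b11`, the interval hypothesis, the small-field inductive assumptions and the
flow control (2.6): for `k < K`, if `ρ_k` of record has the repaired §2 form then `𝐓ρ_k` of record has the repaired 𝐓-image form» (`SLaw₁₃ θ P k →
TLaw₁₃ θ P k`; [III] §1 for `k = 0`, §3 + Thm 2 for `k ≥ 1`) — via the n11-a lineage's construction-generic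
`B14NodeKnitRecord9.b14_main_at_construction_rhoOfRecord9_along` (densities `rhoOfRecord9 … (EOfRecord₁₃ θ) … (gOfRecord₁₃ θ p)`, `densOfRecord₁₃` by
`rfl`) with `LawsP := SLaw₁₃`, `LawsTP := TLaw₁₃`, `hS9 := Iff.rfl`, `h0 := sLaw₁₃_zero`, `hR :=` the pin.

WHAT THIS FILE PROVES (0 `sorry`, 0 `def`, standard axioms).  §1 POINTED, at Stage-13 parameters `θ` under their provisos `h` and a world `w` with `w.C =
(datumOfRecord₁₃ F N θ h).C`, `w.up P = upOfRecord₅C F N (θ.toStage5₁₃ F N) P` (the leaf unfolded = seat dag-n24-c's `B16NodeKnitRecord13.rOperation_iff_laws₁₃`,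
imported): `densitiesDescribed_iff_sLaw₁₃`
(N11's CONCLUSION at `(w, P)` IS «every `ρ_k` of record, `k ≤ K`, has the repaired §2 form, Stage 13»), **`b14_main_at_record₁₃`** (N11 from (S1ᵀ)₁₃
ALONE — the form a `stub_nodes13` prover consumes at the K1‴ witness), **`b14_main_iff_at_record₁₃`** (N11 UNFOLDED at ₁₃C, both directions),
`sLaw₁₃_all_of_b14_main` (A4 locator: what N11 asserts at the objects of record — NON-VACUOUS: the `k = 0` instance is a theorem), `sLaw₁₃_all_of_tLaw`
(Thm 1 [III]'s conclusion along the run from (S1ᵀ)₁₃ + the leaf's law transport, no world), `sLaw₁₃_all_of_rOpLeaf` (the same from the 𝐑-leaf BY NAME,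
`DagBinding.ROpLeaf (VOfRecord₁₃ θ P)` — the N11∕N13 junction at ₁₃).  §2 KEYED on `IsRecordOfRecord₁₃C`: `leaf_b7_of_isRecordOfRecord₁₃C`,
`guards_of_isRecordOfRecord₁₃C` (in-edges `b4 b5 b7` HOLD at every run of every Stage-13 record, `Record13` §7's transfers),
**`b14_main_of_isRecordOfRecord₁₃C`** (per-(D, w): (S1ᵀ)₁₃ for every presenting `θ` ⇒ N11 at every run), **`s_N11_of_refines₁₃C`**, **`s_N11_rec₁₃C`**
(`S_N11` AT `IsRecordOfRecord₁₃C · N` ITSELF from (S1ᵀ)₁₃ alone).  §3 THE (B)-FACE: `thm1Printed_of_isRecordOfRecord₁₃C_of_b14Step` (at a Stage-13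
record: (S1ᵀ)₁₃ + the antecedents inside the window ⊢ `B16.Thm1Printed D.C` — what the K1‴ witness owes N11, by name; def-T's leaf-keyed form with the
𝐑-leaves as a hypothesis is `Node00.thm1Printed_of_isRecordOfRecord₁₃C_of_tLaw`, cited, not re-derived), `nodes_b14_of_isRecordOfRecord₁₃C` (the N11
CONJUNCT of `DagBinding.Nodes` — the eleventh of thirteen — at every run of a Stage-13 record from (S1ᵀ)₁₃: the exact shape `stub_nodes13` asks of N11).

HONEST FRAMING.  A count-neutral KNIT BY NAME (R429 (4)(i)); N11 is NOT discharged: (S1ᵀ)₁₃ = [III] Sects. 1–3 + Thm 2 at the Stage-13 slots of record is a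
DISPLAYED hypothesis (Bałaban's renormalization-transformation estimates, proved nowhere in the tree for the objects of record); (S0) is a theorem of
`Record13`; the (𝐑) slot is NOT assumed — it is what the record's leaf SAYS ([II′] Thm 1's content, node N13's product); the in-edges `b8 b9 b10 b11`
(N05 ∕ N06 ∕ N08 ∕ N07), the small-field leaf (N09 ∧ N10) and the flow control stay antecedents AS PRINTED.  `IsRecordOfRecord₁₃C` is NOT known inhabited
(K0‴ at rev 16); RIDER №7: `N`-generic (`[NeZero N]`), the route instantiates `F 2`.  This file never reads the record's `bg` proviso (Record13 v1.1: def-R's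
ranged `BgProvisoΛ`) nor the (2.9) letter `ε₂₉`; both are invisible here.  LOCATED (as at ₁₂, dag-ref-H (S3),
this seat's `…N11FirstSlotAtRecord12` §5): the residual 𝐓-weight datum `Zt` is bound by `ζ0 ≥ 0` and locality only, so the ∀-record forms of §2 are correct
IMPLICATIONS whose hypothesis `step` is dischargeable only over record classes excluding degenerate weights, and THE DISCHARGE CURRENCY FOR N11 IS THE
POINTED FORM `b14_main_at_record₁₃` AT THE K1‴ WITNESS `θ` (print's partition of unity `θ.ZtUnity`) — exactly where [III]'s Theorem of p. 245 is a statement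
about Bałaban's operation 𝐓.  One finite four-torus programme at fixed `ε`, Bałaban AS PRINTED with locators; NOT ℝ⁴, NOT infinite volume, NOT OS, NOT a
mass gap, NOT Clay.  Sources: [III] Thm 1 p. 262, Theorem p. 245, p. 244, (2.18) p. 257, (2.23)–(2.42) pp. 258–261, Thm 2 p. 263, (3.24)–(3.25) p. 270;
[II′] Thm 1 p. 355; [Balaban1989LargeFieldI] (0.2)–(0.4) p. 176; [I] (2.9) p. 266 (the χ species of the ₁₃ β-layer).
-/

noncomputable section

open scoped BigOperators

namespace Summit.QuantumFields.YangMills.Theorems.BalabanUVNodesN11AtRecord13C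

open Literature.MathematicalPhysics.QuantumFieldTheory.Balaban1983to89
open Literature.MathematicalPhysics.QuantumFieldTheory.Balaban1983to89.T4Continuum (T4Family FiniteEpsData)
open Literature.MathematicalPhysics.QuantumFieldTheory.Balaban1983to89.DagBinding (WorldP leavesP Nodes)
open Literature.MathematicalPhysics.QuantumFieldTheory.Balaban1983to89.Node00
open Literature.MathematicalPhysics.QuantumFieldTheory.Balaban1983to89.B14NodeKnitRecord9
  (b14_main_at_construction_rhoOfRecord9_along densitiesDescribed_iff_laws_construction)
open Summit.QuantumFields.YangMills.Theorems.BalabanUVNodesN11AtRecord12C (thm1Printed_of_b14_main_all)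
open Literature.MathematicalPhysics.QuantumFieldTheory.Balaban1983to89.B16NodeKnitRecord13 (rOperation_iff_laws₁₃)
open YMDAG.UVSplit (Datum RecordPred AtRecord S_N11)

variable (F : T4Family) (N : ℕ) [NeZero N]

/-! ## §1. N11 at a Stage-13 world, POINTED at the presenting parameters -/

section Pointed

variable (θ : Stage13Params F N) (h : θ.Provisos₁₃ F N) (w : WorldP) (P : B12.RunParams)

-- The record's 𝐑-leaf at the run `P`, UNFOLDED at Stage 13 — `(leavesP w P).rOperation ↔ ∀ k < K, TLaw₁₃ θ P k → SLaw₁₃ θ P (k+1)` — is seat dag-n24-c's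
-- `B16NodeKnitRecord13.rOperation_iff_laws₁₃` (module 36, landed first); it is IMPORTED and used by name below, not restated.

/-- **N11's CONCLUSION at a Stage-13 world IS «every density of record `ρ_k`, `k ≤ K`, has the REPAIRED §2 [III] form of record, Stage 13»** (`SLaw₁₃ θ P k`:
the post-𝐑 slot family at the Stage-13 𝐓-weights, setting and background maps of record, whole-slot dichotomy, `Node00.sLaw₁₃_iff`): the core's clause is
the pin (`sect2Form_coreOfRecord₁₃_iff`, `Iff.rfl`). [cite: Balaban1988Convergent, Thm 1 p.262, (2.18) p.257, (2.23)–(2.42) pp.258–261 (bookkeeping)] -/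
theorem densitiesDescribed_iff_sLaw₁₃ (hC : w.C = (datumOfRecord₁₃ F N θ h).C) :
    (leavesP w P).densitiesDescribed ↔ ∀ k, k ≤ P.K → SLaw₁₃ F N θ P k :=
  densitiesDescribed_iff_laws_construction F N (coreOfRecord₁₃ F N θ) w P θ.ν θ.τ9 (EOfRecord₁₃ F N θ)
    (wOfRecord₉ F N θ.toStage9Params) θ.ppSel (gOfRecord₁₃ F N θ) (fun p k _ => SLaw₁₃ F N θ p k)
    (hC.trans (datumOfRecord₁₃_C F N θ h)) (fun _ _ => Iff.rfl)

/-- **N11 AT A STAGE-13 WORLD FROM (S1ᵀ)₁₃ ALONE** ([Balaban1988Convergent] Thm 1 p. 262 with the Theorem of p. 245; the 𝐑 of p. 244 DISCHARGED BY THE PIN,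
the START by `Node00.sLaw₁₃_zero`): at `w.C = (datumOfRecord₁₃ F N θ h).C`, `w.up P = upOfRecord₅C F N (θ.toStage5₁₃ F N) P`, `Dag.B14_main (leavesP w P)`
follows from (S1ᵀ)₁₃ `hT` — THE THEOREM OF p. 245 AT THE STAGE-13 OBJECTS OF RECORD: GIVEN N11's in-edges `b7 … b11`, the interval hypothesis, the
small-field inductive assumptions and the flow control (2.6), for `k < K`, `SLaw₁₃ θ P k → TLaw₁₃ θ P k` ([III] §1 for `k = 0`, §3 + Thm 2 for `k ≥ 1`).
n11-a's `B14NodeKnitRecord9.b14_main_at_construction_rhoOfRecord9_along` BY NAME along `gOfRecord₁₃ θ` with `h0 := sLaw₁₃_zero` — the form a prover of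
the rev-16 stub `stub_nodes13` consumes at the K1‴ witness. [cite: Balaban1988Convergent, Thm 1 p.262; Theorem p.245; p.244; (2.18) p.257; (3.24)–(3.25) p.270] -/
theorem b14_main_at_record₁₃ (hC : w.C = (datumOfRecord₁₃ F N θ h).C) (hup : w.up P = upOfRecord₅C F N (θ.toStage5₁₃ F N) P)
    (hT : (leavesP w P).b7 → (leavesP w P).b8 → (leavesP w P).b9 → (leavesP w P).b10 → (leavesP w P).b11 →
      (leavesP w P).smallCouplings → (leavesP w P).smallFieldInductive → (leavesP w P).flowControl →
        ∀ k, k < P.K → SLaw₁₃ F N θ P k → TLaw₁₃ F N θ P k) :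
    Dag.B14_main (leavesP w P) :=
  b14_main_at_construction_rhoOfRecord9_along F N (coreOfRecord₁₃ F N θ) w P θ.ν θ.τ9 (EOfRecord₁₃ F N θ)
    (wOfRecord₉ F N θ.toStage9Params) θ.ppSel (gOfRecord₁₃ F N θ) (fun p k _ => SLaw₁₃ F N θ p k)
    (fun p k _ => TLaw₁₃ F N θ p k) (hC.trans (datumOfRecord₁₃_C F N θ h)) (fun _ _ => Iff.rfl) (fun _ => sLaw₁₃_zero F N θ P) hT
    (fun hrop => (rOperation_iff_laws₁₃ F N θ w P hup).1 hrop)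

/-- **N11 UNFOLDED AT A STAGE-13 WORLD — what the node SAYS there, both directions**: `Dag.B14_main (leavesP w P)` IS «`b7 → b8 → b9 → b10 → b11 →
(smallCouplings → smallFieldInductive) → (smallCouplings → flowControl) → (∀ k < K, TLaw₁₃ θ P k → SLaw₁₃ θ P (k+1)) → smallCouplings → ∀ k ≤ K,
SLaw₁₃ θ P k`». [cite: Balaban1988Convergent, Thm 1 p.262; Theorem p.245; p.244 (the node statement read at the Stage-13 objects of record; bookkeeping)] -/
theorem b14_main_iff_at_record₁₃ (hC : w.C = (datumOfRecord₁₃ F N θ h).C) (hup : w.up P = upOfRecord₅C F N (θ.toStage5₁₃ F N) P) :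
    Dag.B14_main (leavesP w P) ↔
      ((leavesP w P).b7 → (leavesP w P).b8 → (leavesP w P).b9 → (leavesP w P).b10 → (leavesP w P).b11 →
        ((leavesP w P).smallCouplings → (leavesP w P).smallFieldInductive) →
        ((leavesP w P).smallCouplings → (leavesP w P).flowControl) →
        (∀ k, k < P.K → TLaw₁₃ F N θ P k → SLaw₁₃ F N θ P (k + 1)) →
        (leavesP w P).smallCouplings → ∀ k, k ≤ P.K → SLaw₁₃ F N θ P k) := by
  unfold Dag.B14_main
  rw [rOperation_iff_laws₁₃ F N θ w P hup, densitiesDescribed_iff_sLaw₁₃ F N θ h w P hC]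

/-- **What N11 SAYS at Stage 13** (A4 locator, NON-VACUOUS: `SLaw₁₃ θ P 0` holds, the rest are the repaired format laws): N11 at a Stage-13-bound run, with its
in-edge leaves, the small-field implication, the flow-control implication, law transport along the tower of record and the interval hypothesis, YIELDS the
repaired §2 [III] form of record of EVERY density `ρ_k`, `k ≤ K`. [cite: Balaban1988Convergent, Thm 1 p.262, (2.18) p.257, (2.23)–(2.42) pp.258–261 (what the node asserts at the objects of record)] -/
theorem sLaw₁₃_all_of_b14_main (hC : w.C = (datumOfRecord₁₃ F N θ h).C) (hup : w.up P = upOfRecord₅C F N (θ.toStage5₁₃ F N) P)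
    (hN : Dag.B14_main (leavesP w P)) (h7 : (leavesP w P).b7) (h8 : (leavesP w P).b8) (h9 : (leavesP w P).b9) (h10 : (leavesP w P).b10)
    (h11 : (leavesP w P).b11) (hsf : (leavesP w P).smallCouplings → (leavesP w P).smallFieldInductive)
    (hfc : (leavesP w P).smallCouplings → (leavesP w P).flowControl) (hR : ∀ k, k < P.K → TLaw₁₃ F N θ P k → SLaw₁₃ F N θ P (k + 1))
    (hsc : (leavesP w P).smallCouplings) : ∀ k, k ≤ P.K → SLaw₁₃ F N θ P k :=
  (b14_main_iff_at_record₁₃ F N θ h w P hC hup).1 hN h7 h8 h9 h10 h11 hsf hfc hR hsc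

end Pointed

/-- **THEOREM 1 [III]'s CONCLUSION ALONG A RUN FROM (S1ᵀ)₁₃ AND THE LEAF'S LAW TRANSPORT, NO WORLD** — the induction (0.2) of [Balaban1988Convergent] p. 262 at
the Stage-13 objects of record (start `sLaw₁₃_zero`, step `SLaw₁₃ k → TLaw₁₃ k → SLaw₁₃ (k+1)`): for every `θ` and run, (S1ᵀ)₁₃ `∀ k < K, SLaw₁₃ θ P k →
TLaw₁₃ θ P k` and (𝐑) `∀ k < K, TLaw₁₃ θ P k → SLaw₁₃ θ P (k+1)` give `∀ k ≤ K, SLaw₁₃ θ P k`.  Pure logic.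
[cite: Balaban1988Convergent, Thm 1 p.262, Theorem p.245, p.244 (the printed induction at the objects of record)] -/
theorem sLaw₁₃_all_of_tLaw (θ : Stage13Params F N) (P : B12.RunParams)
    (hT : ∀ k, k < P.K → SLaw₁₃ F N θ P k → TLaw₁₃ F N θ P k) (hR : ∀ k, k < P.K → TLaw₁₃ F N θ P k → SLaw₁₃ F N θ P (k + 1)) :
    ∀ k, k ≤ P.K → SLaw₁₃ F N θ P k := by
  intro k
  induction k with
  | zero => exact fun _ => sLaw₁₃_zero F N θ P
  | succ k ih => exact fun hk => hR k hk (hT k hk (ih (Nat.le_of_succ_le hk)))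

/-- **THEOREM 1 [III] AT STAGE 13 RELATIVE TO 𝐑, BY NAME** (the N11∕N13 junction at ₁₃): the record's 𝐑-leaf at the pinned carriers
`DagBinding.ROpLeaf (VOfRecord₁₃ F N θ P)` (= [III] p. 244's assumed property of 𝐑 at the Stage-13 objects of record, `rOpLeaf_VOfRecord₁₃_iff`; node N13's
product) + (S1ᵀ)₁₃ give the repaired §2 form of EVERY density of record `ρ_k`, `k ≤ K` — no world, no start hypothesis.
[cite: Balaban1988Convergent, Thm 1 p.262, Theorem p.245, p.244; Balaban1989LargeFieldII, Thm 1 p.355] -/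
theorem sLaw₁₃_all_of_rOpLeaf (θ : Stage13Params F N) (P : B12.RunParams)
    (hT : ∀ k, k < P.K → SLaw₁₃ F N θ P k → TLaw₁₃ F N θ P k) (hR : DagBinding.ROpLeaf (VOfRecord₁₃ F N θ P)) :
    ∀ k, k ≤ P.K → SLaw₁₃ F N θ P k :=
  sLaw₁₃_all_of_tLaw F N θ P hT ((rOpLeaf_VOfRecord₁₃_iff F N θ P).1 hR)

/-! ## §2. KEYED on the record predicate `IsRecordOfRecord₁₃C`; the route's stub `S_N11` -/

section Keyed

variable {F N}
variable {D : FiniteEpsData F (SU N)} {w : WorldP}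

/-- **N04's leaf `b7` HOLDS OUTRIGHT at every run of every Stage-13 record** (N01 `b4`, N02 `b4 → b5`, N04 `b5 → b7` are NODE 00 theorems at the ₅C shadow,
transferred by `Record13` §7 — `Node00.b4∕b5∕b7_main_of_isRecordOfRecord₁₃C`). [cite: Balaban1985Averaging, Props. 1–10 pp.26–50 (kernel version at the objects of record, transferred; bookkeeping)] -/
theorem leaf_b7_of_isRecordOfRecord₁₃C (hrec : IsRecordOfRecord₁₃C F N D w) (P : B12.RunParams) : (leavesP w P).b7 :=
  b7_main_of_isRecordOfRecord₁₃C hrec P (b5_main_of_isRecordOfRecord₁₃C hrec P (b4_main_of_isRecordOfRecord₁₃C hrec P))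

/-- **In-edge guards at every run of a Stage-13 record**: `b4`, `b5`, `b7` HOLD (only `b8 b9 b10 b11` — N05 ∕ N06 ∕ N08 ∕ N07 — remain antecedents).
[cite: Balaban1983RegularityDecay, Theorem p.573; Balaban1984PropagatorsI, Props. 1.1–1.2 pp.33–36; Balaban1985Averaging, Props. 1–10 pp.26–50 (kernel versions, transferred; bookkeeping)] -/
theorem guards_of_isRecordOfRecord₁₃C (hrec : IsRecordOfRecord₁₃C F N D w) (P : B12.RunParams) :
    (leavesP w P).b4 ∧ (leavesP w P).b5 ∧ (leavesP w P).b7 :=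
  have h4 : (leavesP w P).b4 := b4_main_of_isRecordOfRecord₁₃C hrec P
  have h5 : (leavesP w P).b5 := b5_main_of_isRecordOfRecord₁₃C hrec P h4
  ⟨h4, h5, b7_main_of_isRecordOfRecord₁₃C hrec P h5⟩

/-- **N11 AT EVERY RUN OF A STAGE-13 RECORD from (S1ᵀ)₁₃ at the objects of record of every presenting parameter**: if for every admissible `θ` satisfying its
Stage-13 provisos and presenting `D` (with the world's binding clauses) and every run, the Theorem of [Balaban1988Convergent] p. 245 holds at the Stage-13
objects of record given N11's antecedents (`SLaw₁₃ θ P k → TLaw₁₃ θ P k`, `k < K`), then `Dag.B14_main (leavesP w P)` at every run `P` — the START being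
`sLaw₁₃_zero` and the (𝐑) slot the record's pin. [cite: Balaban1988Convergent, Thm 1 p.262; Theorem p.245; p.244; Balaban1989LargeFieldII, Thm 1 p.355] -/
theorem b14_main_of_isRecordOfRecord₁₃C (hrec : IsRecordOfRecord₁₃C F N D w)
    (step : ∀ (θ : Stage13Params F N) (h : θ.Provisos₁₃ F N), θ.Admissible F N → D = datumOfRecord₁₃ F N θ h →
      w.C = (datumOfRecord₁₃ F N θ h).C → (0 < w.γ ∧ w.γ ≤ θ.γ) → w.L = (θ.L : ℝ) →
      (∀ P, w.up P = upOfRecord₅C F N (θ.toStage5₁₃ F N) P) → ∀ P : B12.RunParams,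
        (leavesP w P).b7 → (leavesP w P).b8 → (leavesP w P).b9 → (leavesP w P).b10 → (leavesP w P).b11 →
          (leavesP w P).smallCouplings → (leavesP w P).smallFieldInductive → (leavesP w P).flowControl →
            ∀ k, k < P.K → SLaw₁₃ F N θ P k → TLaw₁₃ F N θ P k) :
    ∀ P : B12.RunParams, Dag.B14_main (leavesP w P) := by
  intro P
  obtain ⟨θ, h, hθ, hD, hC, hγ, hL, hup⟩ := hrec
  exact b14_main_at_record₁₃ F N θ h w P (by rw [hC, hD]) (hup P) (step θ h hθ hD (by rw [hC, hD]) hγ hL hup P)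

/-- **`S_N11 Rec` FOR EVERY RECORD PREDICATE REFINING THE STAGE-13 RECORD** (the route's node stub `YMDAG.UVSplit.S_N11 Rec := AtRecord Rec Dag.B14_main`), from
(S1ᵀ)₁₃ alone at the objects of record of every presenting Stage-13 parameter of every `Rec`-world.
[cite: Balaban1988Convergent, Thm 1 p.262; Theorem p.245; p.244; (2.18) p.257; Balaban1989LargeFieldII, Thm 1 p.355] -/
theorem s_N11_of_refines₁₃C (Rec : RecordPred N)
    (href : ∀ (F : T4Family) (D : Datum F N) (w : WorldP), Rec F D w → IsRecordOfRecord₁₃C F N D w)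
    (step : ∀ (F : T4Family) (D : Datum F N) (w : WorldP), Rec F D w →
      ∀ (θ : Stage13Params F N) (h : θ.Provisos₁₃ F N), θ.Admissible F N → D = datumOfRecord₁₃ F N θ h →
        w.C = (datumOfRecord₁₃ F N θ h).C → (0 < w.γ ∧ w.γ ≤ θ.γ) → w.L = (θ.L : ℝ) →
        (∀ P, w.up P = upOfRecord₅C F N (θ.toStage5₁₃ F N) P) → ∀ P : B12.RunParams,
          (leavesP w P).b7 → (leavesP w P).b8 → (leavesP w P).b9 → (leavesP w P).b10 → (leavesP w P).b11 →
            (leavesP w P).smallCouplings → (leavesP w P).smallFieldInductive → (leavesP w P).flowControl →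
              ∀ k, k < P.K → SLaw₁₃ F N θ P k → TLaw₁₃ F N θ P k) :
    S_N11 Rec :=
  fun F D w hR P => b14_main_of_isRecordOfRecord₁₃C (href F D w hR) (step F D w hR) P

/-- **`S_N11` AT THE STAGE-13 RECORD ITSELF** (`Rec := IsRecordOfRecord₁₃C · N`; the route instantiates `N := 2`): N11 at every run of every Stage-13 record's
world from (S1ᵀ)₁₃ ALONE — THE THEOREM OF [Balaban1988Convergent] p. 245 at the Stage-13 objects of record being the one displayed estimate; the start is a
theorem, the 𝐑-half the record's pin. [cite: Balaban1988Convergent, Thm 1 p.262; Theorem p.245; p.244; Balaban1989LargeFieldII, Thm 1 p.355] -/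
theorem s_N11_rec₁₃C
    (step : ∀ (F : T4Family) (D : Datum F N) (w : WorldP), IsRecordOfRecord₁₃C F N D w →
      ∀ (θ : Stage13Params F N) (h : θ.Provisos₁₃ F N), θ.Admissible F N → D = datumOfRecord₁₃ F N θ h →
        w.C = (datumOfRecord₁₃ F N θ h).C → (0 < w.γ ∧ w.γ ≤ θ.γ) → w.L = (θ.L : ℝ) →
        (∀ P, w.up P = upOfRecord₅C F N (θ.toStage5₁₃ F N) P) → ∀ P : B12.RunParams,
          (leavesP w P).b7 → (leavesP w P).b8 → (leavesP w P).b9 → (leavesP w P).b10 → (leavesP w P).b11 →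
            (leavesP w P).smallCouplings → (leavesP w P).smallFieldInductive → (leavesP w P).flowControl →
              ∀ k, k < P.K → SLaw₁₃ F N θ P k → TLaw₁₃ F N θ P k) :
    S_N11 (fun F D w => IsRecordOfRecord₁₃C F N D w) :=
  s_N11_of_refines₁₃C _ (fun _ _ _ hR => hR) step

end Keyed

/-! ## §3. THE (B)-FACE at a Stage-13 record and the N11 CONJUNCT of `DagBinding.Nodes` — the DAG's reading of the route's K1‴ -/

section BFace

variable {F N}
variable {D : FiniteEpsData F (SU N)} {w : WorldP}

/-- **AT A STAGE-13 RECORD: Theorem 1's conjunct of (B) from (S1ᵀ)₁₃ at the presenting parameters + N11's antecedents inside the window** — §2's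
`b14_main_of_isRecordOfRecord₁₃C` composed with this seat's stage-free `BalabanUVNodesN11AtRecord12C.thm1Printed_of_b14_main_all` (`w.C = D.C`, `0 < w.γ`
are binding clauses of the record).  What the route's K1‴ witness owes N11, by name: (S1ᵀ)₁₃ at ITS `θ`, and the antecedent leaves at its windowed runs.
(def-T's form keyed on the 𝐑-leaves as a hypothesis is `Node00.thm1Printed_of_isRecordOfRecord₁₃C_of_tLaw`; this one is keyed on the node's antecedents.)
[cite: Balaban1989LargeFieldII, Thm 1 p.355; Balaban1988Convergent, Thm 1 p.262, Theorem p.245] -/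
theorem thm1Printed_of_isRecordOfRecord₁₃C_of_b14Step (hrec : IsRecordOfRecord₁₃C F N D w)
    (step : ∀ (θ : Stage13Params F N) (h : θ.Provisos₁₃ F N), θ.Admissible F N → D = datumOfRecord₁₃ F N θ h →
      w.C = (datumOfRecord₁₃ F N θ h).C → (0 < w.γ ∧ w.γ ≤ θ.γ) → w.L = (θ.L : ℝ) →
      (∀ P, w.up P = upOfRecord₅C F N (θ.toStage5₁₃ F N) P) → ∀ P : B12.RunParams,
        (leavesP w P).b7 → (leavesP w P).b8 → (leavesP w P).b9 → (leavesP w P).b10 → (leavesP w P).b11 →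
          (leavesP w P).smallCouplings → (leavesP w P).smallFieldInductive → (leavesP w P).flowControl →
            ∀ k, k < P.K → SLaw₁₃ F N θ P k → TLaw₁₃ F N θ P k)
    (hant : ∀ P : B12.RunParams, (leavesP w P).smallCouplings →
      (leavesP w P).b7 ∧ (leavesP w P).b8 ∧ (leavesP w P).b9 ∧ (leavesP w P).b10 ∧ (leavesP w P).b11 ∧
        (leavesP w P).smallFieldInductive ∧ (leavesP w P).flowControl ∧ (leavesP w P).rOperation) :
    B16.Thm1Printed D.C :=
  thm1Printed_of_b14_main_all D w (construction_eq_of_isRecordOfRecord₁₃C hrec) (gamma_pos_of_isRecordOfRecord₁₃C hrec)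
    (b14_main_of_isRecordOfRecord₁₃C hrec step) hant

/-- **THE N11 CONJUNCT OF `DagBinding.Nodes` AT A STAGE-13 RECORD** — the exact shape the rev-16 stub `stub_nodes13` («N01–N13 at SOME Stage-13 record») asks of
node N11: at every run of a `IsRecordOfRecord₁₃C` world, the eleventh of the thirteen conjuncts `Dag.B14_main (leavesP w P)` holds from (S1ᵀ)₁₃ at every
presenting parameter (the other twelve conjuncts are the other nodes' business and are NOT touched). [cite: Balaban1988Convergent, Thm 1 p.262; Theorem p.245; p.244 (bookkeeping: the node's place in the conjunction)] -/
theorem nodes_b14_of_isRecordOfRecord₁₃C (hrec : IsRecordOfRecord₁₃C F N D w)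
    (step : ∀ (θ : Stage13Params F N) (h : θ.Provisos₁₃ F N), θ.Admissible F N → D = datumOfRecord₁₃ F N θ h →
      w.C = (datumOfRecord₁₃ F N θ h).C → (0 < w.γ ∧ w.γ ≤ θ.γ) → w.L = (θ.L : ℝ) →
      (∀ P, w.up P = upOfRecord₅C F N (θ.toStage5₁₃ F N) P) → ∀ P : B12.RunParams,
        (leavesP w P).b7 → (leavesP w P).b8 → (leavesP w P).b9 → (leavesP w P).b10 → (leavesP w P).b11 →
          (leavesP w P).smallCouplings → (leavesP w P).smallFieldInductive → (leavesP w P).flowControl →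
            ∀ k, k < P.K → SLaw₁₃ F N θ P k → TLaw₁₃ F N θ P k)
    (P : B12.RunParams)
    (hrest : Dag.B4_main (leavesP w P) ∧ Dag.B5_main (leavesP w P) ∧ Dag.B6_main (leavesP w P) ∧ Dag.B7_main (leavesP w P) ∧
      Dag.B8_main (leavesP w P) ∧ Dag.B9_main (leavesP w P) ∧ Dag.B10_main (leavesP w P) ∧ Dag.B11_main (leavesP w P) ∧
      Dag.B12_main (leavesP w P) ∧ Dag.B13_main (leavesP w P) ∧ Dag.B15_main (leavesP w P) ∧ Dag.B16_main (leavesP w P)) :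
    Nodes (leavesP w P) := by
  obtain ⟨h4, h5, h6, h7, h8, h9, h10, h11, h12, h13, h15, h16⟩ := hrest
  exact ⟨h4, h5, h6, h7, h8, h9, h10, h11, h12, h13, b14_main_of_isRecordOfRecord₁₃C hrec step P, h15, h16⟩

end BFace

end Summit.QuantumFields.YangMills.Theorems.BalabanUVNodesN11AtRecord13C

end
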